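import Mathlib
import HarnessLib
import Literature.Computability.AlgebraicComplexity.TensorPowerAction
import Literature.RepresentationTheory.AlgebraicGroups.FormsHaarAverage
import Literature.RepresentationTheory.AlgebraicGroups.FormsUnitarianTrick

/-!
# The Reynolds operator and Mumford's separation for `SL(σ, ℂ)` acting on tensor powers

Companion of `FormsHaarAverage`, `FormsUnitarianTrick`, `MumfordSeparationProofs` (which treat
`SL(σ, ℂ)` acting on FORMS by linear substitution): the same three steps for the `N`-fold tensor
power action `tensorAct g` of `Matrix σ σ ℂ` on `N`-tensors `(Fin N → σ) → ℂ`
(`Literature/Computability/AlgebraicComplexity/TensorPowerAction.lean`), i.e. for the rational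
representation `g ↦ g^{⊗N}` of `SL(σ, ℂ)` on `(ℂ^σ)^{⊗N}` and its coordinate ring
`ℂ[X_w : w ∈ σ^N]` (`MvPolynomial (Fin N → σ) ℂ`, a polynomial `F` being the function
`v ↦ aeval v F`):

* bookkeeping (§1): the pull-back `F ∘ (g • ·)` is the polynomial
  `aeval (w ↦ ∑_{w'} (∏ₖ g_{w k, w' k}) X_{w'}) F`, homogeneous of the same degree, and
  `g ↦ F(g • v)` is a polynomial in the entries of `g` (generic matrix `Matrix.mvPolynomialX`);
* **Haar averaging** (§2, `exists_haarAverage_tensor`): for `F` homogeneous of degree `i` there is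
  a polynomial `E`, homogeneous of degree `i`, with `E(v) = ∫_{SU(σ)} F(U • v) dU`; it is
  `SU(σ)`-invariant (right invariance of Haar measure on the compact group `SU(σ)`);
* **the unitarian trick** (§3, `aeval_tensorAct_eq_of_specialUnitaryGroup_invariant`): a
  homogeneous `SU(σ)`-invariant polynomial is `SL(σ, ℂ)`-invariant (Weyl; Zariski density of
  `U(σ)` in `M_σ(ℂ)`, `UnitaryZariskiDense`);
* **separation** (§4, `exists_invariant_aeval_ne_zero_of_vanishing`): if a polynomial `P` vanishes on
  the `SL(σ, ℂ)`-orbit of a tensor `T₀` and `P(0) = 1`, then some homogeneous `SL(σ, ℂ)`-invariant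
  polynomial of positive degree does not vanish at `T₀` — Mumford–Fogarty–Kirwan, GIT Ch. 1 §2,
  Cor. 1.2 (the Reynolds operator `E` applied to `P`: `E P` is invariant, `E P = 0` on the orbit,
  and its degree-`0` component is `P(0) = 1`), in the form used by Kempf–Ness arguments
  ("a closed orbit not containing `0` is not in the null cone").

Everything is proved; no definitions and no named facts are introduced (the action, the pull-back
and the averages are written out, as in the forms files).

## References

* D. Mumford, J. Fogarty, F. Kirwan, *Geometric Invariant Theory*, 3rd ed. (1994), Ch. 1 §1
  Def. 1.5 (Reynolds operator), §2 Cor. 1.2 (separation). [MumfordFogartyKirwan1994]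
* H. Weyl, *The Classical Groups* (1939), Ch. VIII §11 (unitarian trick); R. Goodman,
  N. R. Wallach, GTM 255, §3.3.4 and Thm. 11.5.10. [GoodmanWallachGTM255]
* G. Kempf, L. Ness, *The length of vectors in representation spaces*, LNM 732 (1979).
-/

noncomputable section

open MvPolynomial MeasureTheory MeasureTheory.Measure TopologicalSpace
open Literature.Computability.AlgebraicComplexity
open Literature.RepresentationTheory.CompactGroups

namespace Literature.RepresentationTheory.AlgebraicGroups

variable {σ : Type*} [Fintype σ] [DecidableEq σ] {N : ℕ}

/-! ## §1 The tensor power action in coordinates: pull-backs and genericity -/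

section Pullback

omit [DecidableEq σ] in
/-- Pointwise meaning of the pull-back along `v ↦ g • v`: evaluating
`aeval (w ↦ ∑_{w'} C (∏ₖ g (w k) (w' k)) * X w') F` at `v` is evaluating `F` at `tensorAct g v`.
[folklore] -/
theorem aeval_tensorPullback (F : MvPolynomial (Fin N → σ) ℂ) (g : Matrix σ σ ℂ)
    (v : (Fin N → σ) → ℂ) :
    aeval v (aeval (fun w : Fin N → σ => ∑ w' : Fin N → σ,
        C (∏ k, g (w k) (w' k)) * (X w' : MvPolynomial (Fin N → σ) ℂ)) F) =
      aeval (tensorAct g v) F := by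
  rw [aeval_eq_bind₁ (fun w : Fin N → σ => ∑ w' : Fin N → σ,
        C (∏ k, g (w k) (w' k)) * (X w' : MvPolynomial (Fin N → σ) ℂ)), aeval_bind₁]
  have hfun : (fun w : Fin N → σ => aeval v (∑ w' : Fin N → σ,
      C (∏ k, g (w k) (w' k)) * (X w' : MvPolynomial (Fin N → σ) ℂ))) = tensorAct g v := by
    funext w
    rw [tensorAct_apply, _root_.map_sum]
    refine Finset.sum_congr rfl fun w' _ => ?_
    rw [_root_.map_mul, aeval_C, aeval_X, Algebra.algebraMap_self_apply]
  rw [hfun]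

omit [DecidableEq σ] in
/-- The pull-back of a homogeneous polynomial of degree `i` along the (linear) map `v ↦ g • v` is
homogeneous of degree `i`. [folklore] -/
theorem isHomogeneous_tensorPullback {F : MvPolynomial (Fin N → σ) ℂ} {i : ℕ}
    (hF : F.IsHomogeneous i) (g : Matrix σ σ ℂ) :
    (aeval (fun w : Fin N → σ => ∑ w' : Fin N → σ,
        C (∏ k, g (w k) (w' k)) * (X w' : MvPolynomial (Fin N → σ) ℂ)) F).IsHomogeneous i := by
  have h1 : ∀ w : Fin N → σ, (∑ w' : Fin N → σ,
      C (∏ k, g (w k) (w' k)) * (X w' : MvPolynomial (Fin N → σ) ℂ)).IsHomogeneous 1 := fun w =>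
    IsHomogeneous.sum _ _ _ fun w' _ => (isHomogeneous_X ℂ w').C_mul _
  have h := hF.aeval _ h1
  rwa [one_mul] at h

omit [DecidableEq σ] in
/-- The entries of `g • v` are polynomials in the entries of `g`: `(g • v) w` is the evaluation at
`g` of `∑_{w'} v w' • ∏ₖ Z_{w k, w' k}` for the generic matrix `Z`. [folklore] -/
theorem eval_genericTensorAct (g : Matrix σ σ ℂ) (v : (Fin N → σ) → ℂ) (w : Fin N → σ) :
    eval (fun p : σ × σ => g p.1 p.2)
      (∑ w' : Fin N → σ, v w' • ∏ k, (X (w k, w' k) : MvPolynomial (σ × σ) ℂ)) =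
    tensorAct g v w := by
  rw [tensorAct_apply, _root_.map_sum]
  refine Finset.sum_congr rfl fun w' _ => ?_
  rw [smul_eval, _root_.map_prod, mul_comm]
  congr 1
  exact Finset.prod_congr rfl fun k _ => eval_X _

omit [DecidableEq σ] in
/-- For fixed `G` and `v`, the function `g ↦ G(g • v)` is a polynomial in the entries of `g`.
[folklore] -/
theorem eval_aeval_genericTensorAct (G : MvPolynomial (Fin N → σ) ℂ) (g : Matrix σ σ ℂ)
    (v : (Fin N → σ) → ℂ) :
    eval (fun p : σ × σ => g p.1 p.2)
      (aeval (fun w : Fin N → σ => ∑ w' : Fin N → σ,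
        v w' • ∏ k, (X (w k, w' k) : MvPolynomial (σ × σ) ℂ)) G) =
    aeval (tensorAct g v) G := by
  have hc : (eval fun p : σ × σ => g p.1 p.2).comp (algebraMap ℂ (MvPolynomial (σ × σ) ℂ)) =
      RingHom.id ℂ :=
    eval₂Hom_comp_C _ _
  rw [map_aeval, hc]
  have hfun : (fun w : Fin N → σ => eval (fun p : σ × σ => g p.1 p.2)
      (∑ w' : Fin N → σ, v w' • ∏ k, (X (w k, w' k) : MvPolynomial (σ × σ) ℂ))) =
      tensorAct g v := by
    funext w
    exact eval_genericTensorAct g v w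
  exact congrArg (fun f => eval f G) hfun

omit [DecidableEq σ] in
/-- The coefficients of the pull-back `F ∘ (g • ·)` are polynomials in the entries of `g` (the
coefficients of the generic pull-back, computed over the coefficient ring `ℂ[Z]`). [folklore] -/
theorem eval_coeff_genericTensorPullback (F : MvPolynomial (Fin N → σ) ℂ) (g : Matrix σ σ ℂ)
    (α : (Fin N → σ) →₀ ℕ) :
    eval (fun p : σ × σ => g p.1 p.2) (coeff α
      (bind₁ (fun w : Fin N → σ => ∑ w' : Fin N → σ,
          C (∏ k, (X (w k, w' k) : MvPolynomial (σ × σ) ℂ)) * X w')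
        (map (C : ℂ →+* MvPolynomial (σ × σ) ℂ) F))) =
    coeff α (aeval (fun w : Fin N → σ => ∑ w' : Fin N → σ,
      C (∏ k, g (w k) (w' k)) * (X w' : MvPolynomial (Fin N → σ) ℂ)) F) := by
  have hc : (eval fun p : σ × σ => g p.1 p.2).comp (C : ℂ →+* MvPolynomial (σ × σ) ℂ) =
      RingHom.id ℂ :=
    eval₂Hom_comp_C _ _
  rw [← coeff_map, map_bind₁, MvPolynomial.map_map, hc, MvPolynomial.map_id, aeval_eq_bind₁]
  have hfun : (fun w : Fin N → σ => map (eval fun p : σ × σ => g p.1 p.2)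
      (∑ w' : Fin N → σ, C (∏ k, (X (w k, w' k) : MvPolynomial (σ × σ) ℂ)) * X w')) =
      fun w => ∑ w' : Fin N → σ, C (∏ k, g (w k) (w' k)) * (X w' : MvPolynomial (Fin N → σ) ℂ) := by
    funext w
    rw [_root_.map_sum]
    refine Finset.sum_congr rfl fun w' _ => ?_
    rw [_root_.map_mul, map_C, map_X, _root_.map_prod]
    congr 2
    exact Finset.prod_congr rfl fun k _ => eval_X _
  exact congrArg (fun f => coeff α (bind₁ f F)) hfun

omit [DecidableEq σ] in
/-- Scalar matrices act on `N`-tensors by `c ^ N`, so a homogeneous polynomial of degree `i`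
satisfies `F((c • g) • v) = c ^ (N i) F(g • v)`. [folklore] -/
theorem aeval_tensorAct_smul {F : MvPolynomial (Fin N → σ) ℂ} {i : ℕ} (hF : F.IsHomogeneous i)
    (c : ℂ) (g : Matrix σ σ ℂ) (v : (Fin N → σ) → ℂ) :
    aeval (tensorAct (c • g) v) F = c ^ (N * i) * aeval (tensorAct g v) F := by
  rw [tensorAct_smul_left, aeval_eq_eval, eval_smul_of_isHomogeneous hF, ← pow_mul]
  rfl

end Pullback

/-! ## §2 Haar averaging over `SU(σ)` -/

section Haar

/-- `U ↦ F(U • v)` is continuous on `SU(σ)` (a polynomial in the entries of `U`). [folklore] -/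
theorem continuous_aeval_tensorAct (F : MvPolynomial (Fin N → σ) ℂ) (v : (Fin N → σ) → ℂ) :
    Continuous fun U : Matrix.specialUnitaryGroup σ ℂ =>
      aeval (tensorAct (U : Matrix σ σ ℂ) v) F := by
  have h := (MvPolynomial.continuous_eval
    (aeval (fun w : Fin N → σ => ∑ w' : Fin N → σ,
      v w' • ∏ k, (X (w k, w' k) : MvPolynomial (σ × σ) ℂ)) F)).comp
    (continuous_specialUnitaryGroup_entries (σ := σ))
  refine h.congr fun U => ?_
  exact eval_aeval_genericTensorAct F (U : Matrix σ σ ℂ) v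

/-- The coefficients of the pull-back `F ∘ (U • ·)` are continuous functions of `U ∈ SU(σ)`.
[folklore] -/
theorem continuous_coeff_tensorPullback (F : MvPolynomial (Fin N → σ) ℂ) (α : (Fin N → σ) →₀ ℕ) :
    Continuous fun U : Matrix.specialUnitaryGroup σ ℂ =>
      coeff α (aeval (fun w : Fin N → σ => ∑ w' : Fin N → σ,
        C (∏ k, (U : Matrix σ σ ℂ) (w k) (w' k)) * (X w' : MvPolynomial (Fin N → σ) ℂ)) F) := by
  have h := (MvPolynomial.continuous_eval (coeff α
      (bind₁ (fun w : Fin N → σ => ∑ w' : Fin N → σ,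
          C (∏ k, (X (w k, w' k) : MvPolynomial (σ × σ) ℂ)) * X w')
        (map (C : ℂ →+* MvPolynomial (σ × σ) ℂ) F)))).comp
    (continuous_specialUnitaryGroup_entries (σ := σ))
  refine h.congr fun U => ?_
  exact eval_coeff_genericTensorPullback F (U : Matrix σ σ ℂ) α

/-- `U ↦ F(U • v)` is Haar integrable on `SU(σ)`. [folklore] -/
theorem integrable_aeval_tensorAct (F : MvPolynomial (Fin N → σ) ℂ) (v : (Fin N → σ) → ℂ) :
    Integrable (fun U : Matrix.specialUnitaryGroup σ ℂ => aeval (tensorAct (U : Matrix σ σ ℂ) v) F)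
      (haarMeasure (⊤ : PositiveCompacts (Matrix.specialUnitaryGroup σ ℂ))) :=
  CompactGroup.integrable_of_continuous (continuous_aeval_tensorAct F v)

/-- **Haar averaging for the tensor power action.** For `F` homogeneous of degree `i`, the Haar
average `v ↦ ∫_{SU(σ)} F(U • v) dU` is a polynomial, homogeneous of degree `i` (average the
coefficients of the pull-backs `F ∘ (U • ·)`, which are homogeneous of degree `i`). This is the
Reynolds operator of Mumford–Fogarty–Kirwan Ch. 1 §1 Def. 1.5 for `SL(σ, ℂ)` on `ℂ[(ℂ^σ)^{⊗N}]`,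
realised by the unitarian trick. [cite: MumfordFogartyKirwan1994, Ch. 1 §1 Def. 1.5] -/
theorem exists_haarAverage_tensor (F : MvPolynomial (Fin N → σ) ℂ) {i : ℕ} (hF : F.IsHomogeneous i) :
    ∃ E : MvPolynomial (Fin N → σ) ℂ, E.IsHomogeneous i ∧
      ∀ v : (Fin N → σ) → ℂ, aeval v E =
        ∫ U : Matrix.specialUnitaryGroup σ ℂ,
          aeval (tensorAct (U : Matrix σ σ ℂ) v) F ∂(haarMeasure ⊤) := by
  set μ : Measure (Matrix.specialUnitaryGroup σ ℂ) := haarMeasure ⊤ with hμ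
  set S : Finset ((Fin N → σ) →₀ ℕ) := (Finset.univ : Finset (Fin N → σ)).finsuppAntidiag i with hS
  -- the pull-back of `F` along `U`
  set pull : Matrix.specialUnitaryGroup σ ℂ → MvPolynomial (Fin N → σ) ℂ := fun U =>
    aeval (fun w : Fin N → σ => ∑ w' : Fin N → σ,
      C (∏ k, (U : Matrix σ σ ℂ) (w k) (w' k)) * (X w' : MvPolynomial (Fin N → σ) ℂ)) F with hpull
  set c : ((Fin N → σ) →₀ ℕ) → ℂ := fun α => ∫ U, coeff α (pull U) ∂μ with hc
  have hsupp : ∀ U : Matrix.specialUnitaryGroup σ ℂ, (pull U).support ⊆ S := by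
    intro U α hα
    rw [hS, Finset.mem_finsuppAntidiag]
    refine ⟨?_, Finset.subset_univ _⟩
    have hdeg : α.degree = i :=
      degree_eq_of_isHomogeneous (isHomogeneous_tensorPullback hF (U : Matrix σ σ ℂ)) hα
    rw [← hdeg, Finsupp.degree_apply]
    exact (Finset.sum_subset (Finset.subset_univ _) fun x _ hx => Finsupp.notMem_support_iff.1 hx).symm
  refine ⟨∑ α ∈ S, monomial α (c α), ?_, fun v => ?_⟩
  · refine IsHomogeneous.sum _ _ _ fun α hα => isHomogeneous_monomial _ ?_
    rw [hS, Finset.mem_finsuppAntidiag] at hα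
    rw [Finsupp.degree_apply, ← hα.1]
    exact Finset.sum_subset (Finset.subset_univ _) fun x _ hx => Finsupp.notMem_support_iff.1 hx
  · -- weights `w α = v^α`
    set wt : ((Fin N → σ) →₀ ℕ) → ℂ := fun α => α.prod fun n e => v n ^ e with hwt
    have hexp : ∀ U : Matrix.specialUnitaryGroup σ ℂ,
        aeval (tensorAct (U : Matrix σ σ ℂ) v) F = ∑ α ∈ S, coeff α (pull U) * wt α := by
      intro U
      rw [← aeval_tensorPullback F (U : Matrix σ σ ℂ) v, aeval_eq_eval, eval_eq]
      refine Finset.sum_subset (hsupp U) ?_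
      intro α _ hα
      rw [notMem_support_iff.1 hα, zero_mul]
    have hint : ∀ α : (Fin N → σ) →₀ ℕ, Integrable (fun U => coeff α (pull U) * wt α) μ := fun α =>
      (CompactGroup.integrable_of_continuous (continuous_coeff_tensorPullback F α)).mul_const _
    simp_rw [hexp]
    rw [integral_finsetSum S fun α _ => hint α, _root_.map_sum]
    refine Finset.sum_congr rfl fun α _ => ?_
    rw [aeval_monomial, integral_mul_const, Algebra.algebraMap_self_apply]

/-- **`SU(σ)`-invariance of Haar averages**: for `U₀ ∈ SU(σ)`,
`∫ F(U • (U₀ • v)) dU = ∫ F(U • v) dU` (`U • (U₀ • v) = (U U₀) • v` and right invariance of the Haar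
measure of the compact group `SU(σ)`). [folklore] -/
theorem integral_aeval_tensorAct_tensorAct_eq (F : MvPolynomial (Fin N → σ) ℂ) {U₀ : Matrix σ σ ℂ}
    (hU₀ : U₀ ∈ Matrix.specialUnitaryGroup σ ℂ) (v : (Fin N → σ) → ℂ) :
    ∫ U : Matrix.specialUnitaryGroup σ ℂ,
        aeval (tensorAct (U : Matrix σ σ ℂ) (tensorAct U₀ v)) F ∂(haarMeasure ⊤) =
      ∫ U : Matrix.specialUnitaryGroup σ ℂ,
        aeval (tensorAct (U : Matrix σ σ ℂ) v) F ∂(haarMeasure ⊤) := by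
  have h := CompactGroup.integral_mul_right_eq_self_of_isHaarMeasure
    (haarMeasure (⊤ : PositiveCompacts (Matrix.specialUnitaryGroup σ ℂ)))
    (fun U : Matrix.specialUnitaryGroup σ ℂ => aeval (tensorAct (U : Matrix σ σ ℂ) v) F) ⟨U₀, hU₀⟩
  refine Eq.trans ?_ h
  refine integral_congr_ae (Filter.Eventually.of_forall fun U => ?_)
  simp only [Submonoid.coe_mul]
  rw [tensorAct_mul]

end Haar

/-! ## §3 The unitarian trick -/

section Unitarian

/-- **Weyl's unitarian trick for invariants of tensors.** A polynomial on `N`-tensors which is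
homogeneous and `SU(σ)`-invariant is `SL(σ, ℂ)`-invariant: `G(g • v) = G(v)` whenever `det g = 1`.
Proof as for forms (`aeval_act_eq_of_specialUnitaryGroup_invariant`): roots of unity `ζ • 1 ∈ SU(σ)`
force `G = 0` unless `|σ| ∣ N i`; then `G(U • v) = (det U)^e G(v)` on `U(σ)`, a polynomial identity
in the entries of `U`, which extends to all matrices by Zariski density of `U(σ)`
(`eval_eq_of_eval_eq_on_unitaryGroup`). [cite: GoodmanWallachGTM255, §3.3.4 and Thm. 11.5.10] -/
theorem aeval_tensorAct_eq_of_specialUnitaryGroup_invariant (G : MvPolynomial (Fin N → σ) ℂ) {i : ℕ}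
    (hG : G.IsHomogeneous i)
    (hinv : ∀ U : Matrix σ σ ℂ, U ∈ Matrix.specialUnitaryGroup σ ℂ → ∀ v : (Fin N → σ) → ℂ,
      aeval (tensorAct U v) G = aeval v G)
    (g : Matrix σ σ ℂ) (hg : g.det = 1) (v : (Fin N → σ) → ℂ) :
    aeval (tensorAct g v) G = aeval v G := by
  classical
  rcases isEmpty_or_nonempty σ with hσ | hσ
  · have h1 : g = 1 := Subsingleton.elim _ _
    rw [h1]
    exact hinv 1 (one_mem _) v
  set n := Fintype.card σ with hn_def
  have hn : n ≠ 0 := Fintype.card_ne_zero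
  -- Step a: roots of unity
  have hroot : ∀ ζ : ℂ, ζ ^ n = 1 → ∀ w : (Fin N → σ) → ℂ, ζ ^ (N * i) * aeval w G = aeval w G := by
    intro ζ hζ w
    have h1 := hinv _ (smul_one_mem_specialUnitaryGroup hζ hn) w
    rw [aeval_tensorAct_smul hG, tensorAct_one] at h1
    exact h1
  by_cases hdvd : n ∣ N * i
  swap
  · -- `G` vanishes identically
    have hζ := Complex.isPrimitiveRoot_exp n hn
    have hne : Complex.exp (2 * Real.pi * Complex.I / n) ^ (N * i) ≠ 1 :=
      fun h => hdvd ((hζ.pow_eq_one_iff_dvd _).1 h)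
    have hzero : ∀ w : (Fin N → σ) → ℂ, aeval w G = 0 := fun w => by
      have := hroot _ hζ.pow_eq_one w
      have : (Complex.exp (2 * Real.pi * Complex.I / n) ^ (N * i) - 1) * aeval w G = 0 := by
        rw [sub_mul, one_mul, this, sub_self]
      exact (mul_eq_zero.1 this).resolve_left (sub_ne_zero.2 hne)
    rw [hzero, hzero]
  obtain ⟨e, he⟩ := hdvd
  -- Step c: the twisted identity on `U(σ)`
  have hU : ∀ U : Matrix σ σ ℂ, U ∈ Matrix.unitaryGroup σ ℂ → ∀ w : (Fin N → σ) → ℂ,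
      aeval (tensorAct U w) G = U.det ^ e * aeval w G := by
    intro U hUm w
    obtain ⟨c, K, hK, hc, rfl⟩ := exists_smul_mem_specialUnitaryGroup_of_mem_unitaryGroup hUm hn
    rw [aeval_tensorAct_smul hG, hinv K hK w, he, pow_mul, hc]
  -- both sides are polynomials in the entries of `U`: extend to all matrices
  set P : MvPolynomial (σ × σ) ℂ :=
    aeval (fun w : Fin N → σ => ∑ w' : Fin N → σ,
      v w' • ∏ k, (X (w k, w' k) : MvPolynomial (σ × σ) ℂ)) G with hP
  set Q : MvPolynomial (σ × σ) ℂ := (Matrix.mvPolynomialX σ σ ℂ).det ^ e * C (aeval v G) with hQ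
  have hPQ : ∀ A : Matrix σ σ ℂ, eval (fun p : σ × σ => A p.1 p.2) P = aeval (tensorAct A v) G :=
    fun A => eval_aeval_genericTensorAct G A v
  have hQA : ∀ A : Matrix σ σ ℂ, eval (fun p : σ × σ => A p.1 p.2) Q = A.det ^ e * aeval v G := by
    intro A
    have hofA : (Matrix.of fun i j => (fun p : σ × σ => A p.1 p.2) (i, j)) = A := by
      ext i j
      simp
    rw [hQ, map_mul, map_pow, eval_C, Matrix.eval_det_mvPolynomialX, hofA]
  have key := eval_eq_of_eval_eq_on_unitaryGroup P Q (fun U hUm => by rw [hPQ, hQA, hU U hUm]) g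
  rw [hPQ, hQA, hg, one_pow, one_mul] at key
  exact key

end Unitarian

/-! ## §4 The Reynolds operator and Mumford's separation on an orbit -/

section Separation

/-- **The Reynolds operator on a homogeneous polynomial**: for `F` homogeneous of degree `i` there is
a homogeneous `SL(σ, ℂ)`-invariant polynomial `E` of degree `i` with `E(v) = ∫_{SU(σ)} F(U • v) dU`.
[cite: MumfordFogartyKirwan1994, Ch. 1 §1 Def. 1.5] -/
theorem exists_reynolds_tensor (F : MvPolynomial (Fin N → σ) ℂ) {i : ℕ} (hF : F.IsHomogeneous i) :
    ∃ E : MvPolynomial (Fin N → σ) ℂ, E.IsHomogeneous i ∧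
      (∀ g : Matrix σ σ ℂ, g.det = 1 → ∀ v : (Fin N → σ) → ℂ, aeval (tensorAct g v) E = aeval v E) ∧
      ∀ v : (Fin N → σ) → ℂ, aeval v E =
        ∫ U : Matrix.specialUnitaryGroup σ ℂ,
          aeval (tensorAct (U : Matrix σ σ ℂ) v) F ∂(haarMeasure ⊤) := by
  obtain ⟨E, hEhom, hEavg⟩ := exists_haarAverage_tensor F hF
  refine ⟨E, hEhom, fun g hg v => ?_, hEavg⟩
  have hinv : ∀ U : Matrix σ σ ℂ, U ∈ Matrix.specialUnitaryGroup σ ℂ → ∀ w : (Fin N → σ) → ℂ,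
      aeval (tensorAct U w) E = aeval w E := by
    intro U hU w
    rw [hEavg, hEavg]
    exact integral_aeval_tensorAct_tensorAct_eq F hU w
  exact aeval_tensorAct_eq_of_specialUnitaryGroup_invariant E hEhom hinv g hg v

/-- **Mumford's separation on an orbit** (GIT Ch. 1 §2 Cor. 1.2, for the closed invariant sets `{0}`
and an `SL(σ, ℂ)`-orbit in `(ℂ^σ)^{⊗N}`, in the form used by Kempf–Ness arguments): if a polynomial `P`
vanishes on the `SL(σ, ℂ)`-orbit of the tensor `T₀` and `P(0) = 1`, then there is a homogeneous
`SL(σ, ℂ)`-invariant polynomial `E` of positive degree with `E(T₀) ≠ 0`. Proof: average the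
homogeneous components `Pᵢ` of `P` over `SU(σ)` (`exists_reynolds_tensor`); the averages `Eᵢ` sum at
`T₀` to `∫ P(U • T₀) dU = 0` (`SU ⊆ SL`), and `E₀ = P(0) = 1`, so some `Eᵢ(T₀) ≠ 0` with `i ≥ 1`.
[cite: MumfordFogartyKirwan1994, Ch. 1 §2 Cor. 1.2] -/
theorem exists_invariant_aeval_ne_zero_of_vanishing (T₀ : (Fin N → σ) → ℂ)
    (P : MvPolynomial (Fin N → σ) ℂ)
    (hP : ∀ g : Matrix σ σ ℂ, g.det = 1 → aeval (tensorAct g T₀) P = 0)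
    (hP0 : aeval (0 : (Fin N → σ) → ℂ) P = 1) :
    ∃ (i : ℕ) (E : MvPolynomial (Fin N → σ) ℂ), 0 < i ∧ E.IsHomogeneous i ∧
      (∀ g : Matrix σ σ ℂ, g.det = 1 → ∀ v : (Fin N → σ) → ℂ, aeval (tensorAct g v) E = aeval v E) ∧
      aeval T₀ E ≠ 0 := by
  classical
  choose E hEhom hEinv hEavg using fun i : ℕ =>
    exists_reynolds_tensor (homogeneousComponent i P) (homogeneousComponent_isHomogeneous i P)
  -- the averages sum to the average of `P`, which vanishes at `T₀`
  have hsum : ∑ i ∈ Finset.range (P.totalDegree + 1), aeval T₀ (E i) = 0 := by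
    simp_rw [hEavg]
    rw [← integral_finsetSum _ fun i _ => integrable_aeval_tensorAct _ T₀]
    have h0 : ∀ U : Matrix.specialUnitaryGroup σ ℂ,
        ∑ i ∈ Finset.range (P.totalDegree + 1),
          aeval (tensorAct (U : Matrix σ σ ℂ) T₀) (homogeneousComponent i P) = 0 := by
      intro U
      rw [← _root_.map_sum (aeval _) (fun i => homogeneousComponent i P), sum_homogeneousComponent]
      exact hP _ (Matrix.mem_specialUnitaryGroup_iff.1 U.2).2
    simp_rw [h0]
    exact integral_zero _ _
  -- the degree-zero average is `P(0) = 1`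
  have hzero : aeval T₀ (E 0) = 1 := by
    rw [hEavg]
    have hc0 : coeff 0 P = 1 := by
      have h := hP0
      rw [aeval_eq_eval, MvPolynomial.eval_zero] at h
      exact h
    have h0 : ∀ U : Matrix.specialUnitaryGroup σ ℂ,
        aeval (tensorAct (U : Matrix σ σ ℂ) T₀) (homogeneousComponent 0 P) = 1 := by
      intro U
      rw [homogeneousComponent_zero, aeval_C, Algebra.algebraMap_self_apply, hc0]
    simp_rw [h0]
    exact integral_const_specialUnitaryGroup 1
  -- so some positive-degree average does not vanish at `T₀`
  have hsum' : ∑ i ∈ Finset.range (P.totalDegree + 1) \ {0}, aeval T₀ (E i) = -1 := by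
    have hmem : ({0} : Finset ℕ) ⊆ Finset.range (P.totalDegree + 1) := by simp
    have := Finset.sum_sdiff hmem (f := fun i => aeval T₀ (E i))
    rw [hsum, Finset.sum_singleton, hzero] at this
    linear_combination this
  obtain ⟨i, hi, hne⟩ : ∃ i ∈ Finset.range (P.totalDegree + 1) \ {0}, aeval T₀ (E i) ≠ 0 := by
    by_contra h
    push Not at h
    rw [Finset.sum_eq_zero h] at hsum'
    norm_num at hsum'
  rw [Finset.mem_sdiff, Finset.mem_singleton] at hi
  exact ⟨i, E i, Nat.pos_of_ne_zero hi.2, hEhom i, hEinv i, hne⟩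

end Separation

end Literature.RepresentationTheory.AlgebraicGroups

end
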